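import Summits.HodgeConjecture.HodgeConjecture.Theorems.Ring2ClassTargetsRowsSixSeven
import Literature.AlgebraicGeometry.HodgeTheory.WeilClassesCMReduction
import HarnessLib

/-!
# Ring 2 around `HC_CM` — rows `6, 7`: the census re-targeted to WEIL PULL-BACKS (X2′) and its price (typer 1)

HONEST FRAMING (page 1, verbatim in every file of this cell): research route conditional on HC_CM; not a
corollary; Q11.4-sentence-2 already refuted in dim ≥ 3.

`HC_CM` := `Theses.RankFourFaces.CMAbelianHodge` (item stmt-HodgeConjecture-3052) is OPEN and occurs below only
as a HYPOTHESIS, by name. The census crux X2 = `Theses.SevenfoldWeilCensus.CodimTwoFromLowerDim` (stmt-18721),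
X1 = `CodimThreeWeilGeneration` (stmt-18720), the cell `W₆` = `WeilSixfolds` (stmt-2524), the ladder rung R3 =
`WeilTypeLadder.WeilClassesCMField` and André's 1992 theorem (the refereed NAMED FACT
`Andre1992_hodgeClasses_cmAbelianVariety_mem_span_pullback_weilClasses`; Charles–Schnell Thm. 11.5.21) are used
BY NAME as hypotheses, never asserted. No `sorry`, no new named fact. New DEFINITIONS: the typed re-target X2′
(a conjecture node, `[status: open]`) and its companion predicates (§W0), nothing else.

WHY THIS FILE (sequel to `Ring2ClassTargetsRowsSixSeven`, same namespace; answers the director's X2 flag of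
2026-08-19 and hodge-weil CARVER v26 (27b): "nobody in the b2b-hweil lineage files ¬X2 or X2′"). X2 as typed —
"every rational `(2,2)` class on an abelian 6- or 7-fold lies in `D² ⊔` pull-backs of `(2,2)` classes from
dimension `< dim A`" — is refuted AT EVIDENCE LEVEL on two families (item stmt-18721, evidence files): (a) CM
products (`B × E′ × E″`, `B` of CM type `(ℚ(ζ₂₄), {1,5,7,13})`: `dim B² = 19 = 15 + 4`; hodge-weil jobs j038435,
j038496; kernel census `PohlmannSetsZeta24ProductSixfold`); (b) the cell's NON-CM "K3-partner" sixfolds `Y × Z`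
(`Y` simple, `End⁰(Y) = E` a quartic CM field, signature `{(2,0),(1,1)}`, `Z` the CM surface with
`T(Z) ≅ det_E H¹(Y)`; `4` exceptional classes in `det_E H¹(Y) ⊗ T(Z)`; atlas-2 `Ring2AtlasSixfolds`, motiv engine
M2, atlas-1 engines A1–A3: `b₂ − d₂ = 4`) and their dim-7 twin `E_k × Y₆`. In print, Moonen–Zarhin's census in
dimension `5` reads "generated by divisor classes together with the PULL-BACKS OF THE WEIL CLASSES" (Math. Ann.
315 (1999) Thm. 0.2 (e), (f) — journal numbering; = the dimension-5 Theorem, cases (e), (f), of arXiv:math/9901113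
p. 1), and André 1992 proves that on a CM abelian variety EVERY
Hodge class is a sum of pull-backs `g^*ω` of Weil classes `ω ∈ ⋀^{2k}_K H¹(B)` of Weil-type abelian varieties `B`
of ANY dimension (`K` imaginary quadratic, `dim B = 2k`; or `K` a CM field of degree `e > 2`, `e·2k = 2 dim B`).
Family (a) therefore CONFORMS to the André-shaped statement (hodge-weil carver g2's suggestion, with X2's
lower-dimensional summand kept)
  X2′ (`CodimTwoFromWeilPullbacks`): `c ∈ D²(A) ⊔ span{pull-backs of (2,2) classes from dim < dim A}
        ⊔ span{g^*ω : ω a rational (2,2) Weil class of a Weil-type B of any dimension}`,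
by a REFEREED theorem (§W1 `codimTwoFromWeilPullbacks_iff_off_cmType_of_andre1992`: granted André's fact, X2′ is
equivalent to X2′ demanded OFF the CM locus). Family (b) conforms too, by a COMPUTATION (evidence
`K3-WEIL-PULLBACK.md` on stmt-18721: hand proof §1 plus enumerations by TWO INDEPENDENT IMPLEMENTATIONS — this
seat's A/B and referee 2's `ref2_k3wp_check_g29.py` written from the statement alone, 0 mismatches; referee 1
reproduced A/B — the cell's certification rule; NOT in print, NOT a Lean theorem, NOT asserted here, nothing below
depends on it): the four classes are `(id_Y × Δ_Z)^*` of the `E`-Weil classes `⋀⁴_E H¹(Y × Z × Z) ⊗ ℂ` for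
an `E`-structure on `Z × Z` making the EIGHTFOLD `Y × Z × Z` of `E`-Weil type (`[E:ℚ] = 4`, `E`-rank `4`,
`n_σ = 2` for all `σ`; every configuration for `Gal = C₄, D₄, C₂ × C₂`, and the twin via `Y₆ × E_k × E_k`). So X2′
survives every recorded witness; it is OPEN off the CM locus and killable by the same Mumford–Tate censuses.

THE PRICE, typed (`CodimTwoWeilClassesCMFieldOff`): pull-backs are algebraic only if their sources are. The
imaginary-quadratic sources are FOURFOLDS (floor `HCUpToDim 5`); the CM-field sources have dimension `2e ≥ 8`,
OUTSIDE rows `≤ 7`. The repaired reduction (§W2): HC on `𝒞`, X2′ off `𝒞`, X1 off `𝒞`, `W₆` off `𝒞`, the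
codimension-2 Weil classes of CM-FIELD Weil type off `𝒞` (= the `2m = 4` slice of R3) and the floor give
`HCUpToDim 7`; modulo these, rows `≤ 7` are again EXACTLY `W₆` off `𝒞`, but the modulus now reaches above
dimension `7` — the honest cost of the re-target. For `𝒞 = IsOfCMType` under `HC_CM` (§W3) every input is
demanded on NON-CM varieties only; the K3-partner cell then sits inside "X2′ off CM" (conforming) and its price is
R3 at (`E` quartic, `m = 2`) on the NON-CM decomposable eightfolds `Y × Z × Z` — a cell of the transport column
(`Ring2TransportWeilClasses`, the `(E, 4, δ)` components of `Ring2Hypotheses…`), not a new kind of input.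
§W4 audit: every HC-shaped statement here follows from `HodgeConjecture`; X2′ and X1 are Hodge-theoretic
generation statements, NOT consequences of HC, and are never asserted.

References (bib keys): Andre1992HodgeCM (Théorème), CharlesSchnell2014Notes (Thm. 11.5.21, Def. 11.5.19),
Deligne1982HodgeCycles (endnote M.12, §5), MoonenZarhin1999LowDim (journal Thm. 0.2 (e), (f) and (2.7)–(2.8) =
arXiv:math/9901113 p. 1 Theorem (e), (f) and §2 — equation numbers are blank in the arXiv text; §5),
MoonenZarhin1998WeilClasses (§1), Vangeemen2001 (§2.9, the half twist: nearest print to (b)), Milne1999 (§2, §7),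
Markman2025SecantWeil (Thm. 1.5.1; UNREFEREED), VoisinHodgeI2002 (Thms. 6.25, 11.30), Deligne2000 (§1).
-/

set_option linter.dupNamespace false

noncomputable section

open CategoryTheory Literature.AlgebraicGeometry Literature.AlgebraicGeometry.Motives
open Literature.AlgebraicGeometry.HodgeTheory Literature.AlgebraicGeometry.Milne1999
open Literature.AlgebraicTopology.SingularHomology Literature.Barriers.HodgeConjecture

namespace Summit.HodgeConjecture.HodgeConjecture.Ring2.ClassTargets

/-! ## §W0 The typed re-target X2′ and its companions (definitions; nothing asserted) -/

/-- X2's second summand: pull-backs to `A` of rational `(2,2)` classes of abelian varieties of dimension `< dim A`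
(verbatim the set in `Theses.SevenfoldWeilCensus.CodimTwoFromLowerDim`). [cite: MoonenZarhin1999LowDim, Thm. 0.2 and §5] -/
def codimTwoLowerDimPullbacks (A : AbelianVariety ℂ) : Set (complexBetti A.X (2 * 2)) :=
  {w' | ∃ (C : AbelianVariety ℂ) (g : A.X ⟶ C.X) (w : complexBetti C.X (2 * 2)), C.dim < A.dim ∧
    IsRationalClass w ∧ IsOfHodgeType C.dim C.X (2 * 2) 2 2 w ∧ w' = complexBetti.map g (2 * 2) w}

/-- **André's pull-backs in codimension `2`**: pull-backs `g^*ω` to `A`, along ANY morphism `g : A.X ⟶ B.X`, of a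
rational `(2,2)` Weil class `ω` of (i) an abelian FOURFOLD `B` with `ψ ≫ ψ = -d` (`ω ∈ weilClassesOf B ψ 2 d`,
`K = ℚ(√-d)`), or (ii) an abelian variety `B` of dimension `2e` with `K = ℚ(ψ) ≅ ℚ[T]⁄(P)` a CM field of degree
`e > 2` acting (`ω ∈ weilClassesField B ψ P 4`). VERBATIM the union in the named fact
`Andre1992_hodgeClasses_cmAbelianVariety_mem_span_pullback_weilClasses` at `k = 2` (so that fact applies by `rfl`).
[cite: Andre1992HodgeCM, Théorème] [cite: CharlesSchnell2014Notes, Thm. 11.5.21] [cite: MoonenZarhin1998WeilClasses, §1] -/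
def codimTwoWeilPullbacks (A : AbelianVariety ℂ) : Set (complexBetti A.X (2 * 2)) :=
  {c' : complexBetti A.X (2 * 2) |
      ∃ (B : AbelianVariety ℂ) (g : A.X ⟶ B.X) (d : ℕ) (ψ : B ⟶ B) (w : complexBetti B.X (2 * 2)),
        B.dim = 2 * 2 ∧ 0 < d ∧ ψ ≫ ψ = -(d • 𝟙 B) ∧ IsRationalClass w ∧
          IsOfHodgeType (2 * 2) B.X (2 * 2) 2 2 w ∧ w ∈ weilClassesOf B ψ 2 d ∧
          c' = complexBetti.map g (2 * 2) w} ∪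
    {c' : complexBetti A.X (2 * 2) |
      ∃ (B : AbelianVariety ℂ) (g : A.X ⟶ B.X) (ψ : B ⟶ B) (P : Polynomial ℤ) (e : ℕ)
        (w : complexBetti B.X (2 * 2)),
        P.Monic ∧ P.natDegree = e ∧ 2 < e ∧ Irreducible (P.map (Int.castRingHom ℚ)) ∧
          Polynomial.eval₂ (Int.castRingHom (CategoryTheory.End B)) (ψ : CategoryTheory.End B) P = 0 ∧
          e * (2 * 2) = 2 * B.dim ∧
          (∀ ρ : ℂ, Polynomial.eval₂ (Int.castRingHom ℂ) ρ P = 0 → starRingEnd ℂ ρ ≠ ρ) ∧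
          (∃ Q : Polynomial ℚ, ∀ ρ : ℂ, Polynomial.eval₂ (Int.castRingHom ℂ) ρ P = 0 →
              Polynomial.eval₂ (algebraMap ℚ ℂ) ρ Q = starRingEnd ℂ ρ) ∧
          w ∈ weilClassesField B ψ P (2 * 2) ∧ IsRationalClass w ∧
          IsOfHodgeType B.dim B.X (2 * 2) 2 2 w ∧ c' = complexBetti.map g (2 * 2) w}

/-- **X2′ = `CodimTwoFromWeilPullbacks` (the suggested re-target of X2, stmt-HodgeConjecture-18721).** On every
complex abelian 6- or 7-fold, every rational `(2,2)` class lies in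
`D² ⊔ span(pull-backs of (2,2) classes from dimension < dim A) ⊔ span(André's Weil pull-backs, any dimension)`.
WEAKER than X2 (`codimTwoFromWeilPullbacks_of_codimTwoFromLowerDim`); conforms on the CM locus by André 1992 (§W1)
and on the recorded non-CM witnesses by the cell's computation (module docstring); OPEN off the CM locus; a
Hodge-theoretic generation statement, NOT a consequence of HC. [cite: MoonenZarhin1999LowDim, Thm. 0.2 (e), (f)]
[cite: Andre1992HodgeCM, Théorème] [status: open] -/
@[conjecture] def CodimTwoFromWeilPullbacks : Prop :=
  ∀ A : AbelianVariety ℂ, A.dim = 6 ∨ A.dim = 7 → ∀ c : complexBetti A.X (2 * 2),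
    IsRationalClass c → IsOfHodgeType A.dim A.X (2 * 2) 2 2 c →
      c ∈ divisorClassesSpan A.X A.dim 2 ⊔ Submodule.span ℂ (codimTwoLowerDimPullbacks A) ⊔
        Submodule.span ℂ (codimTwoWeilPullbacks A)

/-- X2′ demanded only OFF a class `𝒞`. [cite: MoonenZarhin1999LowDim, Thm. 0.2 (e), (f)] -/
def CodimTwoFromWeilPullbacksOff (𝒞 : AbelianVariety ℂ → Prop) : Prop :=
  ∀ A : AbelianVariety ℂ, A.dim = 6 ∨ A.dim = 7 → ¬ 𝒞 A → ∀ c : complexBetti A.X (2 * 2),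
    IsRationalClass c → IsOfHodgeType A.dim A.X (2 * 2) 2 2 c →
      c ∈ divisorClassesSpan A.X A.dim 2 ⊔ Submodule.span ℂ (codimTwoLowerDimPullbacks A) ⊔
        Submodule.span ℂ (codimTwoWeilPullbacks A)

/-- X1 (`Theses.SevenfoldWeilCensus.CodimThreeWeilGeneration`, stmt-18720) demanded only OFF `𝒞` — verbatim the
hypothesis `h₂` of `hcUpToDim_seven_of_censusOff`. [cite: MoonenZarhin1999LowDim, §2 and §5] -/
def CodimThreeWeilGenerationOff (𝒞 : AbelianVariety ℂ → Prop) : Prop :=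
  ∀ A : AbelianVariety ℂ, A.dim = 6 ∨ A.dim = 7 → ¬ 𝒞 A → ∀ c : complexBetti A.X (2 * 3),
    IsRationalClass c → IsOfHodgeType A.dim A.X (2 * 3) 3 3 c →
      c ∈ divisorClassesSpan A.X A.dim 3 ⊔ Submodule.span ℂ {w' : complexBetti A.X (2 * 3) |
          ∃ (a : complexBetti A.X (2 * 2)) (b : complexBetti A.X (2 * 1)),
            IsRationalClass a ∧ IsOfHodgeType A.dim A.X (2 * 2) 2 2 a ∧ IsRationalClass b ∧
            IsOfHodgeType A.dim A.X (2 * 1) 1 1 b ∧ w' = cupProduct (two_mul_add_two_mul 2 1) a b} ⊔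
        Submodule.span ℂ {w' : complexBetti A.X (2 * 3) |
          ∃ (C : AbelianVariety ℂ) (g : A.X ⟶ C.X) (w : complexBetti C.X (2 * 3)), C.dim < A.dim ∧
            IsRationalClass w ∧ IsOfHodgeType C.dim C.X (2 * 3) 3 3 w ∧ w' = complexBetti.map g (2 * 3) w} ⊔
        Submodule.span ℂ {w' : complexBetti A.X (2 * 3) |
          ∃ (B : AbelianVariety ℂ) (g : A.X ⟶ B.X) (d : ℕ) (ψ : B ⟶ B) (w : complexBetti B.X (2 * 3)),
            B.dim = 6 ∧ 0 < d ∧ ψ ≫ ψ = -(d • 𝟙 B) ∧ IsRationalClass w ∧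
            IsOfHodgeType B.dim B.X (2 * 3) 3 3 w ∧ w ∈ weilClassesOf B ψ 3 d ∧
            w' = complexBetti.map g (2 * 3) w}

/-- The cell `W₆` (Weil classes of Weil-type sixfolds, Weil-plane spelling) demanded only OFF `𝒞` — verbatim the
hypothesis `h₄` of `hcUpToDim_seven_of_censusOff`. [cite: Markman2025SecantWeil, Thm. 1.5.1] -/
def WeilSixfoldsOff (𝒞 : AbelianVariety ℂ → Prop) : Prop :=
  ∀ (d : ℕ), 0 < d → ∀ (B : AbelianVariety ℂ) (ψ : B ⟶ B), B.dim = 6 → ψ ≫ ψ = -(d • 𝟙 B) → ¬ 𝒞 B →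
    ∀ w : complexBetti B.X (2 * 3), IsRationalClass w → IsOfHodgeType B.dim B.X (2 * 3) 3 3 w →
      w ∈ weilClassesOf B ψ 3 d → w ∈ algebraicClasses B.X 3

/-- **The price of X2′: codimension-2 Weil classes of CM-FIELD Weil type, off `𝒞`** — the `2m = 4` slice of the
ladder rung R3 `WeilTypeLadder.WeilClassesCMField` (`K = ℚ(ψ)` a CM field of degree `e > 2`, `e·4 = 2 dim B`, so
`dim B = 2e ≥ 8`: OUTSIDE rows `≤ 7`), demanded only for `B` outside `𝒞`. OPEN (R3 is open for every such `K`).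
[cite: MoonenZarhin1998WeilClasses, §1] [cite: Deligne1982HodgeCycles, §5] [status: open] -/
def CodimTwoWeilClassesCMFieldOff (𝒞 : AbelianVariety ℂ → Prop) : Prop :=
  ∀ (B : AbelianVariety ℂ) (ψ : B ⟶ B) (P : Polynomial ℤ) (e : ℕ),
    P.Monic → P.natDegree = e → 2 < e → Irreducible (P.map (Int.castRingHom ℚ)) →
    Polynomial.eval₂ (Int.castRingHom (CategoryTheory.End B)) (ψ : CategoryTheory.End B) P = 0 →
    e * (2 * 2) = 2 * B.dim →
    (∀ ρ : ℂ, Polynomial.eval₂ (Int.castRingHom ℂ) ρ P = 0 → starRingEnd ℂ ρ ≠ ρ) →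
    (∃ Q : Polynomial ℚ, ∀ ρ : ℂ, Polynomial.eval₂ (Int.castRingHom ℂ) ρ P = 0 →
        Polynomial.eval₂ (algebraMap ℚ ℂ) ρ Q = starRingEnd ℂ ρ) → ¬ 𝒞 B →
      ∀ w ∈ weilClassesField B ψ P (2 * 2), IsRationalClass w →
        IsOfHodgeType B.dim B.X (2 * 2) 2 2 w → w ∈ algebraicClasses B.X 2

/-! ## §W1 X2′ against X2, against the route items, and on the CM locus (André 1992) -/

/-- **X2 → X2′**: the re-target is WEAKER than the route crux (by name; one more summand). [cite: MoonenZarhin1999LowDim, Thm. 0.2] -/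
theorem codimTwoFromWeilPullbacks_of_codimTwoFromLowerDim (h : Theses.SevenfoldWeilCensus.CodimTwoFromLowerDim) :
    CodimTwoFromWeilPullbacks :=
  fun A hA c hc hct ↦ Submodule.mem_sup_left (h A hA c hc hct)

/-- X2′ gives X2′ off any class. [folklore] -/
theorem codimTwoFromWeilPullbacksOff_of (h : CodimTwoFromWeilPullbacks) (𝒞 : AbelianVariety ℂ → Prop) :
    CodimTwoFromWeilPullbacksOff 𝒞 :=
  fun A hA _ c hc hct ↦ h A hA c hc hct

/-- X1 (route item by name) gives X1 off any class. [folklore] -/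
theorem codimThreeWeilGenerationOff_of (h : Theses.SevenfoldWeilCensus.CodimThreeWeilGeneration)
    (𝒞 : AbelianVariety ℂ → Prop) : CodimThreeWeilGenerationOff 𝒞 :=
  fun A hA _ c hc hct ↦ h A hA c hc hct

/-- `W₆` (stmt-2524, by name) gives `W₆` off any class (`weilSixfoldsOff_of_weilSixfolds`). [cite: Markman2025SecantWeil, Thm. 1.5.1] -/
theorem weilSixfoldsOff_of (h : Theses.SevenfoldWeilCensus.WeilSixfolds) (𝒞 : AbelianVariety ℂ → Prop) :
    WeilSixfoldsOff 𝒞 :=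
  weilSixfoldsOff_of_weilSixfolds 𝒞 h

/-- R3 (`WeilTypeLadder.WeilClassesCMField`, every `m`) gives its codimension-2 slice off any class.
[cite: MoonenZarhin1998WeilClasses, §1] -/
theorem codimTwoWeilClassesCMFieldOff_of_weilClassesCMField (h : WeilTypeLadder.WeilClassesCMField)
    (𝒞 : AbelianVariety ℂ → Prop) : CodimTwoWeilClassesCMFieldOff 𝒞 :=
  fun B ψ P e hP hPe he hirr hev hdim hreal hQ _ w hw hwQ hwt ↦
    h B ψ P e 2 hP hPe he hirr hev hdim hreal hQ w hw hwQ hwt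

/-- **On the CM locus X2′'s clause is André's theorem** (refereed): for `A` of CM type (`IsOfCMType`, verbatim the
fact's hypothesis) every rational `(2,2)` class lies in the span of André's Weil pull-backs, a fortiori in X2′'s
right-hand side. [cite: Andre1992HodgeCM, Théorème] [cite: CharlesSchnell2014Notes, Thm. 11.5.21 (p. 510)] -/
theorem codimTwo_clause_of_andre1992_of_isOfCMType
    (h : Andre1992_hodgeClasses_cmAbelianVariety_mem_span_pullback_weilClasses)
    (A : AbelianVariety ℂ) (hA : IsOfCMType A) (c : complexBetti A.X (2 * 2)) (hc : IsRationalClass c)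
    (hct : IsOfHodgeType A.dim A.X (2 * 2) 2 2 c) :
    c ∈ divisorClassesSpan A.X A.dim 2 ⊔ Submodule.span ℂ (codimTwoLowerDimPullbacks A) ⊔
        Submodule.span ℂ (codimTwoWeilPullbacks A) :=
  Submodule.mem_sup_right (h A AbelianVariety.isSmoothProjective_holds hA 2 c hc hct)

/-- **Granted André's fact, X2′ ↔ X2′ off the CM locus**: the re-target has content only on NON-CM 6- and 7-folds
(where it is open). [cite: Andre1992HodgeCM, Théorème] [cite: Milne1999, §2] -/
theorem codimTwoFromWeilPullbacks_iff_off_cmType_of_andre1992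
    (h : Andre1992_hodgeClasses_cmAbelianVariety_mem_span_pullback_weilClasses) :
    CodimTwoFromWeilPullbacks ↔ CodimTwoFromWeilPullbacksOff IsOfCMType := by
  refine ⟨fun h' ↦ codimTwoFromWeilPullbacksOff_of h' _, fun h' A hA c hc hct ↦ ?_⟩
  by_cases hA𝒞 : IsOfCMType A
  · exact codimTwo_clause_of_andre1992_of_isOfCMType h A hA𝒞 c hc hct
  · exact h' A hA hA𝒞 c hc hct

/-! ## §W2 The repaired sevenfold reduction: X2′ in place of X2, paid for by codimension-2 CM-field Weil classes -/

/-- **The cycle part of HC in dimension `≤ 7` from: HC on `𝒞`, X2′ off `𝒞`, X1 off `𝒞`, `W₆` off `𝒞`, the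
codimension-2 CM-field Weil classes off `𝒞`, the floor.** The strong induction of
`mem_algebraicClasses_of_dim_le_seven_of_censusOff` with two more summands in codimension `2`: a pull-back of a
rational `(2,2)` Weil class of a FOURFOLD is algebraic by the floor, of a CM-field Weil-type `B` by HC on `𝒞` if
`𝒞 B`, else by `h₆` (`map_mem_algebraicClasses_of_abelianVariety`). [cite: MoonenZarhin1999LowDim, §2, §5]
[cite: Andre1992HodgeCM, Théorème] [cite: VoisinHodgeI2002, Thms. 6.25, 11.30] -/
theorem mem_algebraicClasses_of_dim_le_seven_of_censusOff_weilPullbacks {𝒞 : AbelianVariety ℂ → Prop} (h𝒞 : HCOnClass 𝒞)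
    (h₃ : CodimTwoFromWeilPullbacksOff 𝒞) (h₂ : CodimThreeWeilGenerationOff 𝒞) (h₄ : WeilSixfoldsOff 𝒞)
    (h₆ : CodimTwoWeilClassesCMFieldOff 𝒞) (h₅ : HCUpToDim 5) :
    ∀ (n : ℕ) (A : AbelianVariety ℂ), A.dim = n → n ≤ 7 →
      ∀ (p : ℕ) (c : complexBetti A.X (2 * p)), IsRationalClass c →
        IsOfHodgeType A.dim A.X (2 * p) p p c → c ∈ algebraicClasses A.X p := by
  intro n
  induction n using Nat.strong_induction_on with
  | _ n ih =>
  intro A hAn hn7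
  have hX : IsSmoothProjective A.dim A.X := AbelianVariety.isSmoothProjective_holds
  by_cases h5 : A.dim ≤ 5
  · exact fun p c hc hct ↦ (h₅ A h5).2 p c hc hct
  by_cases hA𝒞 : 𝒞 A
  · exact fun p c hc hct ↦ (h𝒞 A hA𝒞).2 p c hc hct
  have h67 : A.dim = 6 ∨ A.dim = 7 := by omega
  have h11 : ∀ b : complexBetti A.X (2 * 1), IsRationalClass b →
      IsOfHodgeType A.dim A.X (2 * 1) 1 1 b → b ∈ algebraicClasses A.X 1 :=
    fun b hb hbt ↦ lefschetzOneOne_rational_holds hX b hb hbt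
  have hpull : ∀ (q : ℕ) (C : AbelianVariety ℂ) (g : A.X ⟶ C.X) (w : complexBetti C.X (2 * q)),
      C.dim < A.dim → IsRationalClass w → IsOfHodgeType C.dim C.X (2 * q) q q w →
        complexBetti.map g (2 * q) w ∈ algebraicClasses A.X q := by
    intro q C g w hC hw hwt
    have hwC : w ∈ algebraicClasses C.X q := ih C.dim (by omega) C rfl (by omega) q w hw hwt
    exact map_mem_algebraicClasses_of_abelianVariety hX C g hwC
  -- codimension `2`: X2′ off `𝒞`; André's pull-backs are algebraic by the floor (fourfolds), resp. `h𝒞`, `h₆`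
  have hweil2 : Submodule.span ℂ (codimTwoWeilPullbacks A) ≤ algebraicClasses A.X 2 := by
    refine Submodule.span_le.mpr ?_
    rintro _ (⟨B, g, d, ψ, w, hB, _, _, hw, hwt, _, rfl⟩ | ⟨B, g, ψ, P, e, w, hP, hPe, he, hirr, hev,
      hdim, hreal, hQ, hweil, hw, hwt, rfl⟩)
    · refine map_mem_algebraicClasses_of_abelianVariety hX B g ((h₅ B (by omega)).2 2 w hw ?_)
      rw [hB]; exact hwt
    · refine map_mem_algebraicClasses_of_abelianVariety hX B g ?_
      by_cases hB𝒞 : 𝒞 B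
      · exact (h𝒞 B hB𝒞).2 2 w hw hwt
      · exact h₆ B ψ P e hP hPe he hirr hev hdim hreal hQ hB𝒞 w hweil hw hwt
  have hp2 : ∀ c : complexBetti A.X (2 * 2), IsRationalClass c →
      IsOfHodgeType A.dim A.X (2 * 2) 2 2 c → c ∈ algebraicClasses A.X 2 := by
    intro c hc hct
    have hlow2 : Submodule.span ℂ (codimTwoLowerDimPullbacks A) ≤ algebraicClasses A.X 2 := by
      refine Submodule.span_le.mpr ?_
      rintro _ ⟨C, g, w, hC, hw, hwt, rfl⟩
      exact hpull 2 C g w hC hw hwt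
    exact (sup_le (sup_le (AbelianVariety.divisorClassesSpan_le_algebraicClasses A h11 2) hlow2) hweil2)
      (h₃ A h67 hA𝒞 c hc hct)
  -- codimension `3`: X1 off `𝒞` (as in `Ring2ClassTargetsRowsSixSeven`)
  have hp3 : ∀ c : complexBetti A.X (2 * 3), IsRationalClass c →
      IsOfHodgeType A.dim A.X (2 * 3) 3 3 c → c ∈ algebraicClasses A.X 3 := by
    intro c hc hct
    have hcup : Submodule.span ℂ {w' : complexBetti A.X (2 * 3) |
        ∃ (a : complexBetti A.X (2 * 2)) (b : complexBetti A.X (2 * 1)),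
          IsRationalClass a ∧ IsOfHodgeType A.dim A.X (2 * 2) 2 2 a ∧ IsRationalClass b ∧
          IsOfHodgeType A.dim A.X (2 * 1) 1 1 b ∧
          w' = cupProduct (two_mul_add_two_mul 2 1) a b} ≤ algebraicClasses A.X 3 := by
      refine Submodule.span_le.mpr ?_
      rintro _ ⟨a, b, ha, hat, hb, hbt, rfl⟩
      exact AbelianVariety.cupProduct_mem_algebraicClasses_one A (hp2 a ha hat) (h11 b hb hbt)
    have hlow3 : Submodule.span ℂ {w' : complexBetti A.X (2 * 3) |
        ∃ (C : AbelianVariety ℂ) (g : A.X ⟶ C.X) (w : complexBetti C.X (2 * 3)), C.dim < A.dim ∧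
          IsRationalClass w ∧ IsOfHodgeType C.dim C.X (2 * 3) 3 3 w ∧
          w' = complexBetti.map g (2 * 3) w} ≤ algebraicClasses A.X 3 := by
      refine Submodule.span_le.mpr ?_
      rintro _ ⟨C, g, w, hC, hw, hwt, rfl⟩
      exact hpull 3 C g w hC hw hwt
    have hweil3 : Submodule.span ℂ {w' : complexBetti A.X (2 * 3) |
        ∃ (B : AbelianVariety ℂ) (g : A.X ⟶ B.X) (d : ℕ) (ψ : B ⟶ B) (w : complexBetti B.X (2 * 3)),
          B.dim = 6 ∧ 0 < d ∧ ψ ≫ ψ = -(d • 𝟙 B) ∧ IsRationalClass w ∧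
          IsOfHodgeType B.dim B.X (2 * 3) 3 3 w ∧ w ∈ weilClassesOf B ψ 3 d ∧
          w' = complexBetti.map g (2 * 3) w} ≤ algebraicClasses A.X 3 := by
      refine Submodule.span_le.mpr ?_
      rintro _ ⟨B, g, d, ψ, w, hB, hd, hψ, hw, hwt, hweil, rfl⟩
      refine map_mem_algebraicClasses_of_abelianVariety hX B g ?_
      by_cases hB𝒞 : 𝒞 B
      · exact (h𝒞 B hB𝒞).2 3 w hw hwt
      · exact h₄ d hd B ψ hB hψ hB𝒞 w hw hwt hweil
    exact (sup_le (sup_le (sup_le (AbelianVariety.divisorClassesSpan_le_algebraicClasses A h11 3)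
      hcup) hlow3) hweil3) (h₂ A h67 hA𝒞 c hc hct)
  have hlow : ∀ p : ℕ, 2 * p ≤ A.dim → ∀ c : complexBetti A.X (2 * p), IsRationalClass c →
      IsOfHodgeType A.dim A.X (2 * p) p p c → c ∈ algebraicClasses A.X p := by
    intro p hp c hc hct
    have hp3' : p ≤ 3 := by omega
    interval_cases p
    · exact hodgeConjectureFor_codim_zero c
    · exact h11 c hc hct
    · exact hp2 c hc hct
    · exact hp3 c hc hct
  intro p c hc hct
  by_cases hp : 2 * p ≤ A.dim
  · exact hlow p hp c hc hct
  · exact mem_algebraicClasses_of_lt_of_nonempty (nonempty_hardLefschetzNFold_holds A.dim A.X) hX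
      (by omega) (hlow (A.dim - p) (by omega)) c hc hct

/-- **Rows `≤ 7` from: HC on `𝒞`, X2′ off `𝒞`, X1 off `𝒞`, `W₆` off `𝒞`, codimension-2 CM-field Weil classes off
`𝒞`, the floor.** [cite: MoonenZarhin1999LowDim, §2, §5] [cite: Andre1992HodgeCM, Théorème] -/
theorem hcUpToDim_seven_of_censusOff_weilPullbacks {𝒞 : AbelianVariety ℂ → Prop} (h𝒞 : HCOnClass 𝒞)
    (h₃ : CodimTwoFromWeilPullbacksOff 𝒞) (h₂ : CodimThreeWeilGenerationOff 𝒞) (h₄ : WeilSixfoldsOff 𝒞)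
    (h₆ : CodimTwoWeilClassesCMFieldOff 𝒞) (h₅ : HCUpToDim 5) : HCUpToDim 7 := fun A hA ↦
  ⟨nonempty_hodgeModel_holds AbelianVariety.isSmoothProjective_holds,
    mem_algebraicClasses_of_dim_le_seven_of_censusOff_weilPullbacks h𝒞 h₃ h₂ h₄ h₆ h₅ A.dim A rfl hA⟩

/-- **EXACTNESS after the re-target: modulo {HC on `𝒞`, X2′ and X1 off `𝒞`, codimension-2 CM-field Weil classes
off `𝒞`, floor}, rows `≤ 7` are EXACTLY the Weil classes of the Weil-type sixfolds outside `𝒞`** (`→` on-path) —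
but the modulus now contains an input from dimension `≥ 8`. [cite: Markman2025SecantWeil, Thm. 1.5.1]
[cite: MoonenZarhin1999LowDim, §5] -/
theorem hcUpToDim_seven_iff_weilSixfoldsOff_of_censusOff_weilPullbacks {𝒞 : AbelianVariety ℂ → Prop} (h𝒞 : HCOnClass 𝒞)
    (h₃ : CodimTwoFromWeilPullbacksOff 𝒞) (h₂ : CodimThreeWeilGenerationOff 𝒞)
    (h₆ : CodimTwoWeilClassesCMFieldOff 𝒞) (h₅ : HCUpToDim 5) :
    HCUpToDim 7 ↔ WeilSixfoldsOff 𝒞 :=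
  ⟨fun h ↦ weilSixfoldsOff_of_weilSixfolds 𝒞 (weilSixfolds_of_hcUpToDim_seven h),
    fun h₄ ↦ hcUpToDim_seven_of_censusOff_weilPullbacks h𝒞 h₃ h₂ h₄ h₆ h₅⟩

/-- **THE REPAIRED CENSUS ASSEMBLY (`𝒞 = ⊥`, route items by name): X2′ → X1 → `W₆` → R3 → floor → rows `≤ 7`**
(= hodge-weil LADDER R7 `WeilTypeLadder.AbelianDimLeSeven`). Compare the route's proved
`closes : X2 → X1 → W₆ → floor → residual → HC_AV`: X2 is replaced by the weaker X2′ at the cost of the rung R3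
(only its `2m = 4` slice is used). [cite: MoonenZarhin1999LowDim, Thm. 0.2, §5] [cite: MoonenZarhin1998WeilClasses, §1] -/
theorem abelianDimLeSeven_of_codimTwoFromWeilPullbacks (h₃ : CodimTwoFromWeilPullbacks)
    (h₂ : Theses.SevenfoldWeilCensus.CodimThreeWeilGeneration) (h₄ : Theses.SevenfoldWeilCensus.WeilSixfolds)
    (hR3 : WeilTypeLadder.WeilClassesCMField) (h₅ : HCUpToDim 5) : WeilTypeLadder.AbelianDimLeSeven :=
  abelianDimLeSeven_iff_hcUpToDim_seven.mpr
    (hcUpToDim_seven_of_censusOff_weilPullbacks (𝒞 := fun _ ↦ False) (fun _ h ↦ h.elim)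
      (codimTwoFromWeilPullbacksOff_of h₃ _) (codimThreeWeilGenerationOff_of h₂ _) (weilSixfoldsOff_of h₄ _)
      (codimTwoWeilClassesCMFieldOff_of_weilClassesCMField hR3 _) h₅)

/-! ## §W3 `𝒞 = IsOfCMType` under `HC_CM`: everything demanded on NON-CM varieties only -/

/-- **Under `HC_CM` (binder by name): rows `≤ 7` from X2′ off CM, X1 off CM, the NON-CM Weil sixfolds, the
codimension-2 Weil classes of NON-CM CM-field Weil-type abelian varieties (dimension `2e ≥ 8`; e.g. the
decomposable eightfolds `Y × Z × Z` behind the K3-partner cell) and the floor.** `HC_CM` enters through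
`hcOnClass_cmType_of_hcCM` only; nothing here is a corollary of `HC_CM`. [cite: Milne1999, §7 (H)]
[cite: Andre1992HodgeCM, Théorème] [cite: MoonenZarhin1999LowDim, §5; arXiv:math/9901113] -/
theorem hcUpToDim_seven_of_hcCM_of_censusOffCM_weilPullbacks (hCM : Theses.RankFourFaces.CMAbelianHodge)
    (h₃ : CodimTwoFromWeilPullbacksOff IsOfCMType) (h₂ : CodimThreeWeilGenerationOff IsOfCMType)
    (h₄ : WeilSixfoldsOff IsOfCMType) (h₆ : CodimTwoWeilClassesCMFieldOff IsOfCMType) (h₅ : HCUpToDim 5) :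
    HCUpToDim 7 :=
  hcUpToDim_seven_of_censusOff_weilPullbacks (hcOnClass_cmType_of_hcCM hCM) h₃ h₂ h₄ h₆ h₅

/-- Same, with X2′ itself (its CM part being André's theorem, `codimTwoFromWeilPullbacks_iff_off_cmType_of_andre1992`)
and the exactness form: under `HC_CM`, modulo {X2′ off CM, X1 off CM, codimension-2 CM-field Weil classes off CM,
floor}, rows `≤ 7` ↔ the NON-CM Weil sixfolds. [cite: Milne1999, §7 (H)] [cite: Markman2025SecantWeil, Thm. 1.5.1] -/
theorem hcUpToDim_seven_iff_nonCMWeilSixfolds_of_hcCM_weilPullbacks (hCM : Theses.RankFourFaces.CMAbelianHodge)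
    (h₃ : CodimTwoFromWeilPullbacksOff IsOfCMType) (h₂ : CodimThreeWeilGenerationOff IsOfCMType)
    (h₆ : CodimTwoWeilClassesCMFieldOff IsOfCMType) (h₅ : HCUpToDim 5) :
    HCUpToDim 7 ↔ WeilSixfoldsOff IsOfCMType :=
  hcUpToDim_seven_iff_weilSixfoldsOff_of_censusOff_weilPullbacks (hcOnClass_cmType_of_hcCM hCM) h₃ h₂ h₆ h₅

/-- **`HC_CM` plus a further granted cell `𝒦`** (`HCOnClass 𝒦`): all inputs demanded only off `CM ∪ 𝒦`.
[cite: Milne1999, §7 (H)] [cite: MoonenZarhin1999LowDim, §5] -/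
theorem hcUpToDim_seven_of_hcCM_of_hcOnClass_weilPullbacks (hCM : Theses.RankFourFaces.CMAbelianHodge)
    {𝒦 : AbelianVariety ℂ → Prop} (h𝒦 : HCOnClass 𝒦)
    (h₃ : CodimTwoFromWeilPullbacksOff fun A ↦ IsOfCMType A ∨ 𝒦 A)
    (h₂ : CodimThreeWeilGenerationOff fun A ↦ IsOfCMType A ∨ 𝒦 A)
    (h₄ : WeilSixfoldsOff fun A ↦ IsOfCMType A ∨ 𝒦 A)
    (h₆ : CodimTwoWeilClassesCMFieldOff fun A ↦ IsOfCMType A ∨ 𝒦 A) (h₅ : HCUpToDim 5) : HCUpToDim 7 :=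
  hcUpToDim_seven_of_censusOff_weilPullbacks (𝒞 := fun A ↦ IsOfCMType A ∨ 𝒦 A)
    (hcOnClass_or_iff.mpr ⟨hcOnClass_cmType_of_hcCM hCM, h𝒦⟩) h₃ h₂ h₄ h₆ h₅

/-! ## §W4 Audit: the HC-shaped statements of this file are on-path -/

/-- `HC_AV → ` the price (every class). [folklore] -/
theorem codimTwoWeilClassesCMFieldOff_of_hodgeAbelianVarieties (h : Theses.PadicSemiregularLift.HodgeAbelianVarieties)
    (𝒞 : AbelianVariety ℂ → Prop) : CodimTwoWeilClassesCMFieldOff 𝒞 :=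
  fun B _ _ _ _ _ _ _ _ _ _ _ _ w _ hwQ hwt ↦ (h B).2 2 w hwQ hwt

/-- Audit: rows `≤ 7`, `W₆` off `𝒞` and the price `CodimTwoWeilClassesCMFieldOff 𝒞` follow from `HodgeConjecture`
(on-path). X2′ and X1 (off `𝒞`) are generation statements, NOT consequences of `HodgeConjecture`, never asserted.
[cite: Deligne2000, §1] -/
theorem rowsSixSevenWeilPullbacks_of_hodgeConjecture (h : _root_.HodgeConjecture) (𝒞 : AbelianVariety ℂ → Prop) :
    HCUpToDim 7 ∧ WeilSixfoldsOff 𝒞 ∧ CodimTwoWeilClassesCMFieldOff 𝒞 :=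
  ⟨hcOnClass_of_hodgeConjecture _ h,
    weilSixfoldsOff_of (weilSixfolds_of_hcAtDim_six (hcOnClass_of_hodgeConjecture _ h)) 𝒞,
    codimTwoWeilClassesCMFieldOff_of_hodgeAbelianVarieties (Ring2.Deform.HC_AV_of_hodgeConjecture h) 𝒞⟩

end Summit.HodgeConjecture.HodgeConjecture.Ring2.ClassTargets
end
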